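import Literature.AnabelianGeometry.AbsoluteAnabelian.AbsTopIChainsCuspidalSplitSurfaceModelOneCusp
import Literature.AnabelianGeometry.SemiGraphs.ProSigmaSurfaceCuspZHatTwist
import HarnessLib

/-!
# [AbsTopI] Lemma 4.5 (v) at split data, the ONCE-PUNCTURED TORUS: F-0206 fails at `G × Δ` for
# EVERY cusped hyperbolic type `(g, r)`, `r ≥ 1` — no exception left

S. Mochizuki, *Topics in Absolute Anabelian Geometry I* [AbsTopI], Lemma 4.5 (v) p. 55 ("by allowing
`H` to vary, this yields a ["group-theoretic"] characterization of the decomposition groups of cusps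
in `Π`"), (vi) p. 55; [SemiAnbd] Example 2.10 p. 31.  abc-iut cell, FACT-LIST row F-0206
`CuspidalAlgorithm.RecoversCusps` (trunk `AbsTopIChains.lean`); D-0079 L-F [AbsTop*]+[AbsAnab] row
«F-0206 ONCE-PUNCTURED TORUS (1,1)» (abc-iut-f-090 gen 5; L4-lead m67 GO).

PROOF-ONLY file (no `def` / `instance` / `structure`).  abc-iut-f-060 proved that at the SPLIT extension
`G × Δ` over a pro-`Σ` completion `Δ` of `Γ_{g,r}` (all cusps marked) no functorial group-theoretic
cuspidal algorithm recovers the cusps, for every hyperbolic `(g, r)` with `r ≥ 1` EXCEPT `(1, 1)`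
(`CuspidalData.exists_split_surfaceGroup_model_not_recoversCusps_of_ne`: transvection `c₁ ↦ c₁ s²` for
`r ≥ 2`, handle swap `a₁ ↔ b₁` for `g ≥ 2` — automorphisms of the DISCRETE group, which at `(1,1)`
cannot work by Nielsen).  This file removes the exception with the PROFINITE twist `b₁ ↦ b₁^λ`
(`λ ∈ Ẑ^×`, `λ ≡ 1 + p (mod p³)`) of `ProSigmaSurfaceCuspZHatTwist.lean`
(`IsProSigmaCompletion.exists_continuousMulEquiv_map_cuspInertia_not_conj_of_genus_pos`, every genus
`≥ 1`):

* `CuspidalData.exists_split_surfaceGroup_model_not_recoversCusps_of_genus_pos` — genus `g ≥ 1`, any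
  `r ≥ 1` cusps: (vi) F-0207, F-0003, F-0405 HOLD and (v) F-0206 FAILS at the split datum;
* `CuspidalData.exists_split_oncePuncturedTorus_not_recoversCusps` — the type `(1, 1)` (the curve type
  of a once-punctured elliptic curve, e.g. a punctured Tate curve): same;
* `CuspidalData.exists_split_surfaceGroup_model_not_recoversCusps_of_cusped` — abc-iut-f-060's
  `…_of_ne` with the hypothesis `(g, r) ≠ (1, 1)` REMOVED: every hyperbolic `(g, r)`, `r ≥ 1`.

So the LF label of F-0206 reads: instance REFUTED at split carriers for EVERY cusped hyperbolic type;
positive only at the cusp-less class (abc-iut-f-052, `AbsTopIChainsCuspidalAlgorithmFamily.lean`); the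
printed Lemma 4.5 (v) rests on its ARITHMETIC input (iii) ([CombGC] weights) at every cusped type.
HONEST FRAMING: classical profinite group theory of surface groups; a split product is not the étale
`π₁` of a curve over an MLF/NF; instance / counter-instance information for assumption labels on OUR
typed statements; nothing here bears on [IUTchIII] Cor 3.12; no abc claim.
-/

noncomputable section

open scoped Pointwise

namespace Literature.AnabelianGeometry.AbsoluteAnabelian.FundamentalExtension

open Literature.AnabelianGeometry.SemiGraphs
open Literature.AnabelianGeometry.SemiGraphs.SemiGraphOfAnabelioids
open Literature.GroupTheory.CombinatorialGroupTheory

/-- **F-0206 is FALSE at genuine geometric data of every genus `≥ 1` with trivial arithmetic action —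
any number `≥ 1` of cusps — while F-0207 / F-0003 / F-0405 hold there.**  For every profinite `G`,
nonempty set of primes `Σ`, `g ≥ 1` and `r ≥ 1`: at the split extension `G × Δ` over a pro-`Σ`
completion `Δ` of `Γ_{g,r}` with all `r` cusps marked (`exists_split_surfaceGroup_model`), (vi) holds
and NO functorial group-theoretic cuspidal algorithm recovers the cusps — the continuous automorphism of
`Δ` twisting `b₁ ↦ b₁^λ` by a unit `λ ≢ ±1` of `Ẑ`
(`exists_continuousMulEquiv_map_cuspInertia_not_conj_of_genus_pos`) moves the class of the cusp `c₁`.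
[AbsTopI] Lemma 4.5 (v) needs its arithmetic input (iii).
[cite: MochizukiAbsTopI2012, Lemma 4.5 (v)(vi) p.55] [cite: MochizukiSemiAnbd2006, Ex. 2.10 p.31] -/
theorem CuspidalData.exists_split_surfaceGroup_model_not_recoversCusps_of_genus_pos
    (G : ProfiniteGrp.{0}) {Sigma : Set ℕ} (hne : Sigma.Nonempty) (hprime : ∀ p ∈ Sigma, p.Prime)
    (g r : ℕ) :
    ∃ (Q : ProfiniteGrp.{0}) (ι : PuncturedSurfaceGroup (g + 1) (r + 1) →* Q)
      (E : FundamentalExtension.{0}) (C : CuspidalData E) (j : C.Cusp ≃ Fin (r + 1)),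
      IsProSigmaCompletion Sigma ι ∧ E.gal = G ∧ E.arith = ProfiniteGrp.of (G × Q) ∧
      (∀ x, Nonempty (↥(C.Icusp x) ≃ₜ*
        ↥((PuncturedSurfaceGroup.cuspInertia (g := g + 1) (j x)).map ι).topologicalClosure)) ∧
      C.DecompEqCommensuratorOfInertia ∧ C.InertiaCommensurablyTerminal ∧ C.DecompEqNormalizer ∧
      ¬ ∃ A : CuspidalAlgorithm.{0}, A.RecoversCusps E C := by
  have hgr : PuncturedSurfaceGroup.IsHyperbolicType (g + 1) (r + 1) := by
    unfold PuncturedSurfaceGroup.IsHyperbolicType; omega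
  obtain ⟨Q, ι, E, C, j, hι, hG, hPi, hI, hvi, h137, h111, hneg⟩ :=
    CuspidalData.exists_split_surfaceGroup_model G hne hprime (g + 1) (r + 1) hgr
  refine ⟨Q, ι, E, C, j, hι, hG, hPi, hI, hvi, h137, h111, hneg (j.symm 0) ?_⟩
  obtain ⟨e, he⟩ :=
    IsProSigmaCompletion.exists_continuousMulEquiv_map_cuspInertia_not_conj_of_genus_pos hne hprime ι hι
  refine ⟨e, fun y q => ?_⟩
  rw [Equiv.apply_symm_apply]
  exact he y q

/-- **The once-punctured torus `(1, 1)`.**  For every profinite `G` and nonempty set of primes `Σ`: at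
`Π = G × Δ`, `Δ` a pro-`Σ` completion of `Γ_{1,1} = F(a, b)` (`c₁ = [a,b]⁻¹`) with its single cusp
marked, [AbsTopI] Lemma 4.5 (vi) (F-0207), [AbsAnab] Lemma 1.3.7 (F-0003) and [AbsTopIII] Thm 1.11 (b)
(F-0405) HOLD and Lemma 4.5 (v) (F-0206) FAILS: no group-theoretic cuspidal algorithm recovers the
cusp — although EVERY automorphism of the discrete `F(a,b)` fixes the class of `[a,b]^{±1}` (Nielsen)
and every abelian character of `Δ` is blind to `c₁`.  [cite: MochizukiAbsTopI2012, Lemma 4.5 (v)(vi) p.55] -/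
theorem CuspidalData.exists_split_oncePuncturedTorus_not_recoversCusps (G : ProfiniteGrp.{0})
    {Sigma : Set ℕ} (hne : Sigma.Nonempty) (hprime : ∀ p ∈ Sigma, p.Prime) :
    ∃ (Q : ProfiniteGrp.{0}) (ι : PuncturedSurfaceGroup 1 1 →* Q)
      (E : FundamentalExtension.{0}) (C : CuspidalData E), IsProSigmaCompletion Sigma ι ∧ E.gal = G ∧
      E.arith = ProfiniteGrp.of (G × Q) ∧ Nonempty (C.Cusp ≃ Fin 1) ∧
      C.DecompEqCommensuratorOfInertia ∧ C.InertiaCommensurablyTerminal ∧ C.DecompEqNormalizer ∧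
      ¬ ∃ A : CuspidalAlgorithm.{0}, A.RecoversCusps E C := by
  obtain ⟨Q, ι, E, C, j, hι, hG, hPi, -, hvi, h137, h111, hneg⟩ :=
    CuspidalData.exists_split_surfaceGroup_model_not_recoversCusps_of_genus_pos G hne hprime 0 0
  exact ⟨Q, ι, E, C, hι, hG, hPi, ⟨j⟩, hvi, h137, h111, hneg⟩

/-- **F-0206 fails at the split datum for EVERY hyperbolic type `(g, r)` with `r ≥ 1` cusps** (while
F-0207 / F-0003 / F-0405 hold there) — abc-iut-f-060's
`exists_split_surfaceGroup_model_not_recoversCusps_of_ne` with its hypothesis `(g, r) ≠ (1, 1)` REMOVED: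
for `(1, 1)` by the profinite twist `b ↦ b^λ`, otherwise by loc. cit. (transvection / handle swap).
[cite: MochizukiAbsTopI2012, Lemma 4.5 (v)(vi) p.55] [cite: MochizukiSemiAnbd2006, Ex. 2.10 p.31] -/
theorem CuspidalData.exists_split_surfaceGroup_model_not_recoversCusps_of_cusped (G : ProfiniteGrp.{0})
    {Sigma : Set ℕ} (hne : Sigma.Nonempty) (hprime : ∀ p ∈ Sigma, p.Prime) (g r : ℕ)
    (hgr : PuncturedSurfaceGroup.IsHyperbolicType g (r + 1)) :
    ∃ (Q : ProfiniteGrp.{0}) (ι : PuncturedSurfaceGroup g (r + 1) →* Q)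
      (E : FundamentalExtension.{0}) (C : CuspidalData E) (j : C.Cusp ≃ Fin (r + 1)),
      IsProSigmaCompletion Sigma ι ∧ E.gal = G ∧ E.arith = ProfiniteGrp.of (G × Q) ∧
      (∀ x, Nonempty (↥(C.Icusp x) ≃ₜ*
        ↥((PuncturedSurfaceGroup.cuspInertia (g := g) (j x)).map ι).topologicalClosure)) ∧
      C.DecompEqCommensuratorOfInertia ∧ C.InertiaCommensurablyTerminal ∧ C.DecompEqNormalizer ∧
      ¬ ∃ A : CuspidalAlgorithm.{0}, A.RecoversCusps E C := by
  rcases g with _ | g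
  · -- genus `0`: `r + 1 ≥ 3`, abc-iut-f-060
    exact CuspidalData.exists_split_surfaceGroup_model_not_recoversCusps_of_ne G hne hprime 0 r hgr
      (by simp)
  · -- genus `≥ 1`: the profinite twist
    exact CuspidalData.exists_split_surfaceGroup_model_not_recoversCusps_of_genus_pos G hne hprime g r

end Literature.AnabelianGeometry.AbsoluteAnabelian.FundamentalExtension

end
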